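import Literature.MeasureTheory.Group.InvariantQuotientNormalized      -- ★ Weil's formula with constant one: `lintegral_fiberLIntegral_quotientMeasure`; `fiberLIntegral`, `quotientMeasure`
import HarnessLib

/-!
# F0 · P3c · line LH6 «StCharTS» — ROAD «JAC-LOC» brick (J6a) «QUOTIENT MASS OF AN OPEN SUBGROUP»:
# `μ_{G/H}(π(K)) · ρ(K ∩ H) = ν(K)` for an open subgroup `K` (Weil's formula at `𝟙_K`; Folland 1995 Thm. 2.49, Deitmar–Echterhoff 2014 Thm. 1.5.3)

Cell `pub/hodgecm-mathlib`, crux H413 = `stmt-HodgeConjecture-24833` (lane `--supports … --as helper`), route HCCMUnconditional; seat LH6-p03 (g5), holder of the road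
«JAC-LOC» (memo `F0/P3b/LH6-p03/g5/ROAD-JAC-LOC.v2.LH6p03g5.md`, bus F0∕P3b 2026-09-02T14:11:30Z).  THEOREMS ONLY, sorry-free, no definition ∕ instance ∕ notation ∕
named fact; GENERIC (any locally compact second countable Hausdorff group `G`, closed subgroup `H`, the tree's invariant quotient measure ★ `quotientMeasure H ρ hH ν`).

WHY (the road's use).  The local tube-Jacobian socket `hJacLoc` of ★ p851645 is checked on product sets `A₀ × V` with `A₀ := π(K_γ) ⊆ G ⧸ T` the image of a small
compact open subgroup and `V = s·(K_γ ∩ T)`; the right-hand side `μ₀(A₀) · ∫_V D dtm` needs the MASS `μ₀(π(K_γ))` of the quotient measure `μ₀ = ν ∕ tm` on that image.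
This file computes it once and for all: **`μ₀(π(K)) · ρ{h ∈ H | h ∈ K} = ν(K)`** (`quotientMeasure_image_mul_measure_eq`), for every OPEN subgroup `K ≤ G`.

THE MATHEMATICS.  Weil's formula (★ `lintegral_fiberLIntegral_quotientMeasure`: `∫_{G/H} f^H dμ_{G/H} = ∫_G f dν`, constant ONE for the tree's `quotientMeasure`) at
`f = 𝟙_K`: the fibre integral `𝟙_K^H(gH) = ρ{h | g h ∈ K}` equals `ρ{h | h ∈ K}` when `gH ∈ π(K)` (write `g = k h₀`, `k ∈ K`, `h₀ ∈ H`; `{h | k h₀ h ∈ K} = h₀⁻¹·{h | h ∈ K}` and `ρ` is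
left invariant) and `0` otherwise (`g h ∈ K ⇒ gH = (gh)H ∈ π(K)`), i.e. `𝟙_K^H = ρ(K ∩ H) · 𝟙_{π(K)}`; integrate.

* §1 `fiberLIntegral_indicator_subgroup` — the fibre integral of `𝟙_K` is `ρ{h | ↑h ∈ K} · 𝟙_{π(K)}` (any subgroup `K` with measurable carrier; no topology on the
  formula itself beyond measurability).
* §2 `quotientMeasure_image_mul_measure_eq` — **`μ_{G/H}(π K) · ρ{h | ↑h ∈ K} = ν K`** for `K` open; `quotientMeasure_image_eq_div` — the solved form
  `μ_{G/H}(π K) = ν K ∕ ρ{h | ↑h ∈ K}` when `0 < ρ{h | ↑h ∈ K} < ∞` (e.g. `K` compact open and `ρ` a Haar measure on `H`).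

HONEST LABEL: count-neutral generic measure theory for the road «JAC-LOC» (hyperbolic half of the print residue «WIF» of the (S-𝔇) organ `stub_EllipticPackage`); closes
no organ.  HC_CM is proved only modulo the 7 printed citations (2 remaining: hLiu418 = `stmt-HodgeConjecture-24832`, h413 = `stmt-HodgeConjecture-24833`) until rung 0 closes.

## References
* [Folland1995] G. B. Folland, *A Course in Abstract Harmonic Analysis* (1995), §2.6 Thm. 2.49 (quotient integral formula).
* [DeitmarEchterhoff2014] A. Deitmar, S. Echterhoff, *Principles of Harmonic Analysis*, 2nd ed. (2014), Thm. 1.5.3.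
* [HarishChandra1970] Harish-Chandra, *Harmonic analysis on reductive p-adic groups*, LNM 162 (1970), Lemma 22 (the consumer: tubes over `π(K) × V`).
-/

set_option autoImplicit false
-- the mandated namespace has the single-problem summit's repeated segment (`HodgeConjecture.HodgeConjecture`)
set_option linter.dupNamespace false

noncomputable section

open MeasureTheory Measure Set
open Literature.MeasureTheory.Group
open scoped ENNReal Pointwise

namespace Summit.HodgeConjecture.HodgeConjecture.Cruxes.H413.F0P3cStCharTSQuotientMassOpenSubgroup

/-! ## §1 The fibre integral of the indicator of a subgroup -/

section Fibre

variable {G : Type*} [Group G] [MeasurableSpace G] (H : Subgroup G) [MeasurableMul H]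
  (ρ : Measure H) [ρ.IsMulLeftInvariant]

/-- **`𝟙_K^H(gH) = ρ{h | g h ∈ K}`**: the fibre integral (★ `fiberLIntegral`) of the indicator of a measurable `K ⊆ G` at `gH` is the `ρ`-measure of the slice
`{h ∈ H | g h ∈ K}`. [cite: Folland1995, §2.6 Thm. 2.49] -/
theorem fiberLIntegral_indicator_mk {K : Set G} (hK : MeasurableSet K) (hmul : ∀ g : G, Measurable fun h : H => g * (h : G)) (g : G) :
    fiberLIntegral H ρ (K.indicator 1) (QuotientGroup.mk g) = ρ {h : H | g * (h : G) ∈ K} := by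
  rw [fiberLIntegral_mk]
  have hset : MeasurableSet {h : H | g * (h : G) ∈ K} := hK.preimage (hmul g)
  rw [← lintegral_indicator_one hset]
  congr 1 with h

/-- **On `π(K)` the slice has full size**: for a SUBGROUP `K` and `g = k h₀` (`k ∈ K`, `h₀ ∈ H`), `{h | g h ∈ K} = h₀⁻¹ · {h | h ∈ K}`, so by left invariance
`ρ{h | g h ∈ K} = ρ{h | h ∈ K}`. [cite: Folland1995, §2.6 Thm. 2.49] -/
theorem measure_slice_eq_of_mem_image (K : Subgroup G) {g : G} (hg : (QuotientGroup.mk g : G ⧸ H) ∈ QuotientGroup.mk '' (K : Set G)) :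
    ρ {h : H | g * (h : G) ∈ (K : Set G)} = ρ {h : H | (h : G) ∈ (K : Set G)} := by
  obtain ⟨k, hk, hkg⟩ := hg
  -- `k⁻¹ g ∈ H`
  have hkg' : k⁻¹ * g ∈ H := QuotientGroup.eq.1 hkg
  set h₀ : H := ⟨k⁻¹ * g, hkg'⟩ with hh₀
  have hgk : g = k * (h₀ : G) := by rw [hh₀]; simp
  have hslice : {h : H | g * (h : G) ∈ (K : Set G)} = (fun h : H => h₀ * h) ⁻¹' {h : H | (h : G) ∈ (K : Set G)} := by
    ext h
    simp only [mem_setOf_eq, mem_preimage, Subgroup.coe_mul, SetLike.mem_coe]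
    rw [hgk, mul_assoc]
    exact ⟨fun hmem => by simpa using K.mul_mem (K.inv_mem hk) hmem, fun hmem => K.mul_mem hk hmem⟩
  rw [hslice, measure_preimage_mul]

omit [MeasurableSpace G] [MeasurableMul H] in
/-- **Off `π(K)` the slice is empty**: if `g h ∈ K` for some `h ∈ H` then `gH = (gh)H ∈ π(K)`. [cite: Folland1995, §2.6 Thm. 2.49] -/
theorem slice_eq_empty_of_not_mem_image (K : Set G) {g : G} (hg : (QuotientGroup.mk g : G ⧸ H) ∉ QuotientGroup.mk '' K) :
    {h : H | g * (h : G) ∈ K} = ∅ := by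
  refine eq_empty_of_forall_notMem fun h hh => hg ⟨g * (h : G), hh, ?_⟩
  rw [QuotientGroup.eq]
  simp

/-- **`𝟙_K^H = ρ{h | h ∈ K} · 𝟙_{π(K)}`** for a subgroup `K` with measurable carrier. [cite: Folland1995, §2.6 Thm. 2.49] [cite: DeitmarEchterhoff2014, Thm. 1.5.3] -/
theorem fiberLIntegral_indicator_subgroup (K : Subgroup G) (hK : MeasurableSet (K : Set G)) (hmul : ∀ g : G, Measurable fun h : H => g * (h : G))
    (x : G ⧸ H) :
    fiberLIntegral H ρ ((K : Set G).indicator 1) x = (QuotientGroup.mk '' (K : Set G)).indicator (fun _ => ρ {h : H | (h : G) ∈ (K : Set G)}) x := by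
  induction x using QuotientGroup.induction_on with
  | H g =>
    rw [fiberLIntegral_indicator_mk H ρ hK hmul g]
    by_cases hg : (QuotientGroup.mk g : G ⧸ H) ∈ QuotientGroup.mk '' (K : Set G)
    · rw [indicator_of_mem hg, measure_slice_eq_of_mem_image H ρ K hg]
    · rw [indicator_of_notMem hg, slice_eq_empty_of_not_mem_image H (K : Set G) hg, measure_empty]

end Fibre

/-! ## §2 The mass of `π(K)` for an open subgroup `K` -/

section Mass

variable {G : Type*} [Group G] [TopologicalSpace G] [IsTopologicalGroup G] [LocallyCompactSpace G]
  [SecondCountableTopology G] [T2Space G] [MeasurableSpace G] [BorelSpace G]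
  (H : Subgroup G) (hH : IsClosed (H : Set G))
  (ρ : Measure H) [ρ.IsMulLeftInvariant] [IsFiniteMeasureOnCompacts ρ] [ρ.IsOpenPosMeasure] [ρ.IsInvInvariant] [SFinite ρ]
  (ν : Measure G) [IsHaarMeasure ν] [ν.IsMulRightInvariant]
  [MeasurableSpace (G ⧸ H)] [BorelSpace (G ⧸ H)]

include hH in
/-- **(J6a) `μ_{G/H}(π K) · ρ{h ∈ H | h ∈ K} = ν(K)`** for an OPEN subgroup `K ≤ G` and the tree's invariant quotient measure `μ_{G/H} = quotientMeasure H ρ hH ν`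
(Weil's formula ★ `lintegral_fiberLIntegral_quotientMeasure` at `f = 𝟙_K`, with §1). [cite: Folland1995, §2.6 Thm. 2.49] [cite: DeitmarEchterhoff2014, Thm. 1.5.3] -/
theorem quotientMeasure_image_mul_measure_eq (K : Subgroup G) (hK : IsOpen (K : Set G)) :
    quotientMeasure H ρ hH ν (QuotientGroup.mk '' (K : Set G)) * ρ {h : H | (h : G) ∈ (K : Set G)} = ν K := by
  haveI : IsClosed (H : Set G) := hH
  have hKm : MeasurableSet (K : Set G) := hK.measurableSet
  have hmul : ∀ g : G, Measurable fun h : H => g * (h : G) := fun g => (continuous_const.mul continuous_subtype_val).measurable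
  have hπK : MeasurableSet (QuotientGroup.mk '' (K : Set G) : Set (G ⧸ H)) := ((QuotientGroup.isOpenMap_coe (N := H)) (K : Set G) hK).measurableSet
  have hWeil := lintegral_fiberLIntegral_quotientMeasure H ρ ν (f := (K : Set G).indicator 1) ((measurable_one.indicator hKm))
  rw [lintegral_indicator_one hKm] at hWeil
  rw [← hWeil]
  have hfun : (fun x => fiberLIntegral H ρ ((K : Set G).indicator 1) x) =
      (QuotientGroup.mk '' (K : Set G)).indicator (fun _ => ρ {h : H | (h : G) ∈ (K : Set G)}) :=
    funext fun x => fiberLIntegral_indicator_subgroup H ρ K hKm hmul x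
  rw [hfun, lintegral_indicator_const hπK, mul_comm]

include hH in
/-- **The solved form `μ_{G/H}(π K) = ν(K) ∕ ρ{h ∈ H | h ∈ K}`** when the fibre mass is positive and finite (e.g. `K` compact open, `ρ` a Haar measure on `H`).
[cite: Folland1995, §2.6 Thm. 2.49] -/
theorem quotientMeasure_image_eq_div (K : Subgroup G) (hK : IsOpen (K : Set G))
    (h0 : ρ {h : H | (h : G) ∈ (K : Set G)} ≠ 0) (htop : ρ {h : H | (h : G) ∈ (K : Set G)} ≠ ∞) :
    quotientMeasure H ρ hH ν (QuotientGroup.mk '' (K : Set G)) = ν K / ρ {h : H | (h : G) ∈ (K : Set G)} := by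
  rw [← quotientMeasure_image_mul_measure_eq H hH ρ ν K hK, ENNReal.mul_div_cancel_right h0 htop]

end Mass

end Summit.HodgeConjecture.HodgeConjecture.Cruxes.H413.F0P3cStCharTSQuotientMassOpenSubgroup

end
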